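import Summits.Ventures.AbcSig.Rows.Bridge
import Summits.Ventures.AbcSig.Rows.C2aL383A0
import Summits.Ventures.AbcSig.Rows.C2aL383A0AB

/-!
# Venture AbcSig — CELL `C2aL383A0`: the census statement `Rows.C2aCellRed 383 (fun a => a = 0) ∅` from the two row theorems

HONEST FRAMING. COMPUTATION cell `pub-abcsig`; CONDITIONAL theorem; no claim on ABC or any summit. Hypotheses exactly as in
`Rows/C2aL383A0.lean` and `Rows/C2aL383A0AB.lean`: `BS04Package` (CITED), `DataComplete` / `RefinesCPSymAll` (COMPUTED, certified level files;
norm-form certificates), and the rows' per-orbit CITED exclusions universally quantified in the exponent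
(shared by both distributions (a = 0: the second is the first with x, y swapped)). Conclusion = p1's census predicate (`Rows/Statements.lean`) with the residual of the row of
record `census/rows/C2a/C2a-l383-a0.md` (sha16 `bec804e3f2c92efe`): all four coprime distributions `A·B = 2^0·383^m`, reduced exponents.
GENERATED by p-lean g4 `gen4/c2arow2.py` (pattern of `Rows/C2aL277A0XCell.lean`).
-/

namespace Summit.Ventures.AbcSig

/-- Cell `C2aL383A0`: `Rows.C2aCellRed 383 (fun a => a = 0) ∅` under the rows' hypotheses. -/
theorem xcell_C2aL383A0 (M : NewformModel) (hP : M.BS04Package)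
    (hD12256 : M.DataComplete 12256 level12256Orbits) (hCP12256 : M.RefinesCPSymAll 12256 level12256CP)
    (hD766 : M.DataComplete 766 level766Orbits) (hCP766 : M.RefinesCPSymAll 766 level766CP)
    (hX_orbit_12256_9 : ∀ n m : ℕ, n ∈ ([11] : List ℕ) → M.Excludes 12256 orbit_12256_9 (famB (2 ^ 0 * 383 ^ m) n (fun _ _ => True)))
    (hX_orbit_12256_10 : ∀ n m : ℕ, n ∈ ([11] : List ℕ) → M.Excludes 12256 orbit_12256_10 (famB (2 ^ 0 * 383 ^ m) n (fun _ _ => True))) :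
    Rows.C2aCellRed 383 (fun a => a = 0) ∅ :=
  C2aCellRed_of_rows 383 (by norm_num) (by norm_num) _ _
    (fun n hn h11 hnℓ _ a m (ha : a = 0) han hm hmn x y z h1 h2 => by
      subst ha
      exact xrow_C2aL383A0 M hP  hD12256 hCP12256 hD766 hCP766 n hn h11 hnℓ  m hm hmn (hX_orbit_12256_9 n m) (hX_orbit_12256_10 n m) x y z h1 h2)
    (fun n hn h11 hnℓ _ a m (ha : a = 0) han hm hmn x y z h1 h2 => by
      subst ha
      exact xrow_C2aL383A0AB M hP  hD12256 hCP12256 hD766 hCP766 n hn h11 hnℓ  m hm hmn (hX_orbit_12256_9 n m) (hX_orbit_12256_10 n m) x y z h1 h2)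

end Summit.Ventures.AbcSig
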